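import Summits.KontsevichZagierPeriods.KontsevichZagierPeriods.Theorems.TerasomaMultiplicationBetaCancellationFibreSubstitution
import Summits.KontsevichZagierPeriods.KontsevichZagierPeriods.Theorems.TerasomaMultiplicationBetaCancellationCatalyticNewtonLeibniz
import Summits.KontsevichZagierPeriods.KontsevichZagierPeriods.Theorems.TerasomaMultiplicationBetaCancellationStubLiftPInjective
import Summits.KontsevichZagierPeriods.KontsevichZagierPeriods.Theorems.TerasomaMultiplicationBetaCancellationStubCatalyticDomainAdd
import Summits.KontsevichZagierPeriods.KontsevichZagierPeriods.Theorems.TerasomaMultiplicationBetaCancellationStubCatalyticIntegrandAdd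
import Literature.NumberTheory.Transcendental.KZProductIdeal

/-!
# `BetaCancellation` (stmt-KontsevichZagierPeriods-13633), line `dirichlet-companion-to-pi` — stub `stub_catalyticProductDescent` (assembly, seat c14 cycle 3): CATALYTIC PRODUCT CERTIFICATES DESCEND

**The certificate class.** Fix a catalyst `p : IntegralRep d` with `p.value ≠ 0` and a
pinned-product family `P n r = p ⊗ r` in the crux's coordinates (catalyst `Fin.castAdd n i`, factor
`Fin.natAdd d j`; e.g. `fun n r => piRep.prod r` for item 0540, `fun n r => (betaRep a b).prod r` for
this crux). The *catalytic product generators* are the four kinds of generators of the KZ calculus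
written between MEMBERS OF THE FAMILY: domain additivity and integrand additivity among
`P n r, P n r₁, P n r₂`; fibre-form substitutions `P n r → P n r'` (rule 2 with
`tail ∘ Φ = ψ ∘ tail`, `ψ` injective and `ℚ`-semialgebraic on the base domain); Newton–Leibniz
moves `P (n+1) s → P n s'` (rule 3 along the last coordinate).

* `stub_catalyticProductDescent` — every formal combination `c` whose lift `lift (of ∘ P) c`
  lies in the subgroup generated by the catalytic product generators is a relation.
* `piCancellation_of_catalyticProductCertificate` — the disc: if `[π] ⋆ c` has such a
  certificate (family `r ↦ piRep.prod r`; `[π] ⋆ c = lift (of ∘ P) c` on the nose,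
  `piRep_mul_eq_lift_prod`), then `c ∈ relations` — `KZ.PiCancellation` (item 0540, open) for this
  certificate class.
* `betaCancellation_of_catalyticProductCertificate` — the crux at ALL positive rational exponents
  for this certificate class: `[β ⊗ r] − [β ⊗ r']` certified among Beta products ⇒ `r ∼ r'`.

**The mechanism.** Generator-wise descent — the one-move theorems
`stub_fibreSubstitution` (p130839), `stub_catalyticNewtonLeibnizDescent` (cycle 2) and the two
additivity stubs `stub_catalyticDomainAdd` (p131213), `stub_catalyticIntegrandAdd` (p131208) — puts
the generated subgroup inside `relations.map (lift (of ∘ P))`; injectivity of the lift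
(`stub_liftP_injective`, p131192: `P n` is injective and `FreeAbelianGroup.map` of an injective map
is injective) turns "generator-wise descent" into "certificate descent" WITHOUT any operator on
certificates. The class is incomparable with every class descended earlier in the tree (fibred,
wall, side, region, weight, weight2: those allow arbitrary intermediate representations but restrict
how a substitution may move the catalyst coordinate; this one keeps every intermediate
representation a product but lets the substitution act arbitrarily on the catalyst fibre). What it
does not contain: a substitution that does not map catalyst fibres into catalyst fibres, and any
certificate leaving the product world (crux notes c14 K3). No definitions; sorry-free; axioms ⊆
{propext, Classical.choice, Quot.sound}.

References: M. Kontsevich, D. Zagier, *Periods* (2001), §1.2; J. Ayoub, *Une version relative de la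
conjecture des périodes de Kontsevich–Zagier*, Ann. of Math. 181 (2015), Rem. 1.3.
-/

noncomputable section

-- `Summit.KontsevichZagierPeriods.KontsevichZagierPeriods.…` is the tree's mandated layout (single-conjunct summit).
set_option linter.dupNamespace false

namespace Summit.KontsevichZagierPeriods.KontsevichZagierPeriods.BetaCancellationLine

open MeasureTheory Set
open Literature.NumberTheory.Transcendental
open Literature.NumberTheory.Transcendental.KZ

/-! ### The assembly -/

/-- STUB (assembly, held by the lead, seat c14 cycle 3). **Catalytic product certificates descend.**
For a catalyst `p` of non-zero value and a pinned-product family `P n r = p ⊗ r` (crux coordinates),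
every formal combination `c` whose lift `lift (of ∘ P) c` lies in the subgroup generated by the
CATALYTIC PRODUCT GENERATORS — domain additivity and integrand additivity among members of the family,
fibre-form substitutions between members (rule 2 with `tail ∘ Φ = ψ ∘ tail`, `ψ` injective and
`ℚ`-semialgebraic on the base domain), and Newton–Leibniz moves between members (rule 3 along the
last coordinate) — is a relation: `c ∈ KZ.relations`. Generator-wise descent (the one-move theorems of
cycles 1–2 and the two additivity stubs) puts that subgroup inside `relations.map (lift (of ∘ P))`,
and injectivity of the lift (`stub_liftP_injective`) finishes. [folklore] -/
theorem stub_catalyticProductDescent {d : ℕ} (p : IntegralRep d) (hp : p.value ≠ 0)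
    (P : ∀ n : ℕ, IntegralRep n → IntegralRep (d + n))
    (hPd : ∀ (n : ℕ) (r : IntegralRep n), (P n r).domain =
      {z | (fun i => z (Fin.castAdd n i)) ∈ p.domain ∧ (fun j => z (Fin.natAdd d j)) ∈ r.domain})
    (hPi : ∀ (n : ℕ) (r : IntegralRep n), (P n r).integrand =
      fun z => p.integrand (fun i => z (Fin.castAdd n i)) * r.integrand (fun j => z (Fin.natAdd d j)))
    (c : FormalRep)
    (hc : FreeAbelianGroup.lift (fun s : (Σ n, IntegralRep n) => of (P s.1 s.2)) c ∈
      AddSubgroup.closure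
        ({x : FormalRep | ∃ (n : ℕ) (r r₁ r₂ : IntegralRep n),
            (P n r).domain = (P n r₁).domain ∪ (P n r₂).domain ∧
            MeasureTheory.volume ((P n r₁).domain ∩ (P n r₂).domain) = 0 ∧
            Set.EqOn (P n r).integrand (P n r₁).integrand (P n r₁).domain ∧
            Set.EqOn (P n r).integrand (P n r₂).integrand (P n r₂).domain ∧
            x = of (P n r) - of (P n r₁) - of (P n r₂)} ∪
        {x : FormalRep | ∃ (n : ℕ) (r r₁ r₂ : IntegralRep n),
            (P n r₁).domain = (P n r).domain ∧ (P n r₂).domain = (P n r).domain ∧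
            Set.EqOn (P n r).integrand ((P n r₁).integrand + (P n r₂).integrand) (P n r).domain ∧
            x = of (P n r) - of (P n r₁) - of (P n r₂)} ∪
        {x : FormalRep | ∃ (n : ℕ) (r r' : IntegralRep n)
            (Φ : (Fin (d + n) → ℝ) → (Fin (d + n) → ℝ))
            (Φ' : (Fin (d + n) → ℝ) → (Fin (d + n) → ℝ) →L[ℝ] (Fin (d + n) → ℝ))
            (ψ : (Fin n → ℝ) → (Fin n → ℝ)) (ψ' : (Fin n → ℝ) → (Fin n → ℝ) →L[ℝ] (Fin n → ℝ)),
            (∀ z ∈ (P n r).domain, HasFDerivWithinAt Φ (Φ' z) (P n r).domain z) ∧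
            Set.InjOn Φ (P n r).domain ∧ (P n r').domain = Φ '' (P n r).domain ∧
            (∀ z ∈ (P n r).domain, (P n r).integrand z = (P n r').integrand (Φ z) * |(Φ' z).det|) ∧
            IsSemialgebraicMapOn ℚ r.domain ψ ∧
            (∀ z ∈ (P n r).domain,
              (fun j => Φ z (Fin.natAdd d j)) = ψ (fun j => z (Fin.natAdd d j))) ∧
            (∀ w ∈ r.domain, HasFDerivWithinAt ψ (ψ' w) r.domain w) ∧ Set.InjOn ψ r.domain ∧
            x = of (P n r) - of (P n r')} ∪
        {x : FormalRep | ∃ (n : ℕ) (s : IntegralRep (n + 1)) (s' : IntegralRep n)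
            (a b : (Fin (d + n) → ℝ) → ℝ) (F : (Fin (d + n + 1) → ℝ) → ℝ),
            IsSemialgebraicFunOn ℚ (P (n + 1) s).domain F ∧
            IsSemialgebraicFunOn ℚ (P n s').domain a ∧ IsSemialgebraicFunOn ℚ (P n s').domain b ∧
            (∀ x ∈ (P n s').domain, a x ≤ b x) ∧
            (P (n + 1) s).domain = {z | (Fin.init z : Fin (d + n) → ℝ) ∈ (P n s').domain ∧
              a (Fin.init z) ≤ z (Fin.last (d + n)) ∧ z (Fin.last (d + n)) ≤ b (Fin.init z)} ∧
            (∀ x ∈ (P n s').domain,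
              ContinuousOn (fun t : ℝ => F (Fin.snoc x t)) (Set.Icc (a x) (b x))) ∧
            (∀ x ∈ (P n s').domain, ∀ t ∈ Set.Ioo (a x) (b x),
              HasDerivAt (fun u : ℝ => F (Fin.snoc x u)) ((P (n + 1) s).integrand (Fin.snoc x t)) t) ∧
            (∀ x ∈ (P n s').domain,
              (P n s').integrand x = F (Fin.snoc x (b x)) - F (Fin.snoc x (a x))) ∧
            x = of (P (n + 1) s) - of (P n s')})) :
    c ∈ relations := by
  set L : FormalRep →+ FormalRep :=
    FreeAbelianGroup.lift (fun s : (Σ n, IntegralRep n) => of (P s.1 s.2)) with hL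
  have hLof : ∀ {m : ℕ} (t : IntegralRep m), L (of t) = of (P m t) := fun t => by
    simp [hL, of]
  -- pinning data of the members of the family, in the form the one-move theorems consume
  have hPi' : ∀ (n : ℕ) (r : IntegralRep n), Set.EqOn (P n r).integrand
      (fun z => p.integrand (fun i => z (Fin.castAdd n i)) *
        r.integrand (fun j => z (Fin.natAdd d j))) (P n r).domain :=
    fun n r z _ => by rw [hPi]
  -- generator-wise descent: the closure lies in `relations.map L`
  have hmem : L c ∈ relations.map L := by
    refine (AddSubgroup.closure_le (K := relations.map L)).2 ?_ hc
    rintro x (((hx | hx) | hx) | hx)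
    · obtain ⟨n, r, r₁, r₂, hdom, hnull, h₁, h₂, rfl⟩ := hx
      exact ⟨of r - of r₁ - of r₂,
        stub_catalyticDomainAdd p hp P hPd hPi r r₁ r₂ hdom hnull h₁ h₂,
        by simp only [map_sub, hLof]⟩
    · obtain ⟨n, r, r₁, r₂, hd₁, hd₂, hadd, rfl⟩ := hx
      exact ⟨of r - of r₁ - of r₂,
        stub_catalyticIntegrandAdd p hp P hPd hPi r r₁ r₂ hd₁ hd₂ hadd,
        by simp only [map_sub, hLof]⟩
    · obtain ⟨n, r, r', Φ, Φ', ψ, ψ', hΦ', hΦinj, himg, hjac, hψsa, hfib, hψ', hψinj, rfl⟩ := hx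
      exact ⟨of r - of r',
        stub_fibreSubstitution p hp r r' (P n r) (P n r') (hPd n r) (hPi' n r) (hPd n r')
          (hPi' n r') Φ Φ' hΦ' hΦinj himg hjac ψ ψ' hψsa hfib hψ' hψinj,
        by simp only [map_sub, hLof]⟩
    · obtain ⟨n, s, s', a, b, F, hF, ha, hb, hab, hdom, hcont, hderiv, hval, rfl⟩ := hx
      exact ⟨of s - of s',
        stub_catalyticNewtonLeibnizDescent p hp s s' (P (n + 1) s) (P n s') (hPd (n + 1) s)
          (hPi' (n + 1) s) (hPd n s') (hPi' n s') a b F hF ha hb hab hdom hcont hderiv hval,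
        by simp only [map_sub, hLof]⟩
  obtain ⟨y, hy, hLy⟩ := hmem
  have hyc : y = c := stub_liftP_injective p hp P hPd hPi hLy
  exact hyc ▸ hy


/-! ### Corollaries: the disc (item 0540's `[π] ⋆ c`) and the Beta products (this crux) -/

section Corollaries

open Summit.KontsevichZagierPeriods.GammaHodgeSectorKO (betaRep betaRep_value_pos)

/-- `[π] ⋆ c` is the lift of `c` along the closed-term disc family `r ↦ piRep.prod r` (convention
`2 + n`; compare `piRep_mul_eq_lift` for the reindexed `n + 2` family). [folklore] -/
theorem piRep_mul_eq_lift_prod (c : FormalRep) :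
    of piRep * c =
      FreeAbelianGroup.lift (fun s : (Σ n, IntegralRep n) => of (piRep.prod s.2)) c := by
  induction c using FreeAbelianGroup.induction_on with
  | zero => simp
  | of s =>
    obtain ⟨m, t⟩ := s
    rw [FreeAbelianGroup.lift_apply_of]
    change of piRep * of t = _
    rw [of_mul_of]
  | neg s ih => rw [mul_neg, map_neg, ih]
  | add x y hx hy => rw [mul_add, map_add, hx, hy]

/-- **`π`-CANCELLATION FOR CATALYTIC PRODUCT CERTIFICATES (a sector of item 0540, seat c14).**
If `[π] ⋆ c` lies in the subgroup generated by the catalytic product generators of the disc family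
`r ↦ [π] ⊗ r` — domain/integrand additivity among disc products, fibre-form substitutions between disc
products, Newton–Leibniz moves between disc products — then `c ∈ KZ.relations`. Compare
`KZ.PiCancellation : ∀ c, [π] ⋆ c ∈ relations → c ∈ relations` (open): here the certificate is
constrained to stay among disc products, with substitutions mapping disc fibres into disc fibres.
[folklore] -/
theorem piCancellation_of_catalyticProductCertificate (c : FormalRep)
    (hc : of piRep * c ∈
      AddSubgroup.closure
        ({x : FormalRep | ∃ (n : ℕ) (r r₁ r₂ : IntegralRep n),
            (piRep.prod r).domain = (piRep.prod r₁).domain ∪ (piRep.prod r₂).domain ∧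
            MeasureTheory.volume ((piRep.prod r₁).domain ∩ (piRep.prod r₂).domain) = 0 ∧
            Set.EqOn (piRep.prod r).integrand (piRep.prod r₁).integrand (piRep.prod r₁).domain ∧
            Set.EqOn (piRep.prod r).integrand (piRep.prod r₂).integrand (piRep.prod r₂).domain ∧
            x = of (piRep.prod r) - of (piRep.prod r₁) - of (piRep.prod r₂)} ∪
        {x : FormalRep | ∃ (n : ℕ) (r r₁ r₂ : IntegralRep n),
            (piRep.prod r₁).domain = (piRep.prod r).domain ∧
            (piRep.prod r₂).domain = (piRep.prod r).domain ∧
            Set.EqOn (piRep.prod r).integrand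
              ((piRep.prod r₁).integrand + (piRep.prod r₂).integrand) (piRep.prod r).domain ∧
            x = of (piRep.prod r) - of (piRep.prod r₁) - of (piRep.prod r₂)} ∪
        {x : FormalRep | ∃ (n : ℕ) (r r' : IntegralRep n)
            (Φ : (Fin (2 + n) → ℝ) → (Fin (2 + n) → ℝ))
            (Φ' : (Fin (2 + n) → ℝ) → (Fin (2 + n) → ℝ) →L[ℝ] (Fin (2 + n) → ℝ))
            (ψ : (Fin n → ℝ) → (Fin n → ℝ)) (ψ' : (Fin n → ℝ) → (Fin n → ℝ) →L[ℝ] (Fin n → ℝ)),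
            (∀ z ∈ (piRep.prod r).domain, HasFDerivWithinAt Φ (Φ' z) (piRep.prod r).domain z) ∧
            Set.InjOn Φ (piRep.prod r).domain ∧
            (piRep.prod r').domain = Φ '' (piRep.prod r).domain ∧
            (∀ z ∈ (piRep.prod r).domain,
              (piRep.prod r).integrand z = (piRep.prod r').integrand (Φ z) * |(Φ' z).det|) ∧
            IsSemialgebraicMapOn ℚ r.domain ψ ∧
            (∀ z ∈ (piRep.prod r).domain,
              (fun j => Φ z (Fin.natAdd 2 j)) = ψ (fun j => z (Fin.natAdd 2 j))) ∧
            (∀ w ∈ r.domain, HasFDerivWithinAt ψ (ψ' w) r.domain w) ∧ Set.InjOn ψ r.domain ∧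
            x = of (piRep.prod r) - of (piRep.prod r')} ∪
        {x : FormalRep | ∃ (n : ℕ) (s : IntegralRep (n + 1)) (s' : IntegralRep n)
            (a b : (Fin (2 + n) → ℝ) → ℝ) (F : (Fin (2 + n + 1) → ℝ) → ℝ),
            IsSemialgebraicFunOn ℚ (piRep.prod s).domain F ∧
            IsSemialgebraicFunOn ℚ (piRep.prod s').domain a ∧
            IsSemialgebraicFunOn ℚ (piRep.prod s').domain b ∧
            (∀ x ∈ (piRep.prod s').domain, a x ≤ b x) ∧
            (piRep.prod s).domain = {z | (Fin.init z : Fin (2 + n) → ℝ) ∈ (piRep.prod s').domain ∧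
              a (Fin.init z) ≤ z (Fin.last (2 + n)) ∧ z (Fin.last (2 + n)) ≤ b (Fin.init z)} ∧
            (∀ x ∈ (piRep.prod s').domain,
              ContinuousOn (fun t : ℝ => F (Fin.snoc x t)) (Set.Icc (a x) (b x))) ∧
            (∀ x ∈ (piRep.prod s').domain, ∀ t ∈ Set.Ioo (a x) (b x),
              HasDerivAt (fun u : ℝ => F (Fin.snoc x u))
                ((piRep.prod s).integrand (Fin.snoc x t)) t) ∧
            (∀ x ∈ (piRep.prod s').domain,
              (piRep.prod s').integrand x = F (Fin.snoc x (b x)) - F (Fin.snoc x (a x))) ∧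
            x = of (piRep.prod s) - of (piRep.prod s')})) :
    c ∈ relations := by
  rw [piRep_mul_eq_lift_prod] at hc
  exact stub_catalyticProductDescent piRep (by rw [piRep_value]; exact Real.pi_ne_zero)
    (fun n r => piRep.prod r) (fun n r => rfl)
    (fun n r => by rw [IntegralRep.piRep_prod_integrand]; rfl) c hc

/-- **THE CRUX FOR CATALYTIC PRODUCT CERTIFICATES, ALL EXPONENTS (seat c14).** For
`0 < a, b ∈ ℚ` and the literal Beta products `β(a,b) ⊗ r` (`(betaRep a b).prod r`): if
`[β ⊗ r] − [β ⊗ r']` lies in the subgroup generated by the catalytic product generators of the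
family `r ↦ β(a,b) ⊗ r`, then `r ∼ r'`. No integrality of the exponents and no passage through
`[π]`. [folklore] -/
theorem betaCancellation_of_catalyticProductCertificate (a₀ b₀ : ℚ) (ha₀ : 0 < a₀)
    (hb₀ : 0 < b₀) {m : ℕ} (r₀ r₀' : IntegralRep m)
    (hc : of ((betaRep a₀ b₀ ha₀ hb₀).prod r₀) - of ((betaRep a₀ b₀ ha₀ hb₀).prod r₀') ∈
      AddSubgroup.closure
        ({x : FormalRep | ∃ (n : ℕ) (r r₁ r₂ : IntegralRep n),
            ((betaRep a₀ b₀ ha₀ hb₀).prod r).domain =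
              ((betaRep a₀ b₀ ha₀ hb₀).prod r₁).domain ∪ ((betaRep a₀ b₀ ha₀ hb₀).prod r₂).domain ∧
            MeasureTheory.volume (((betaRep a₀ b₀ ha₀ hb₀).prod r₁).domain ∩
              ((betaRep a₀ b₀ ha₀ hb₀).prod r₂).domain) = 0 ∧
            Set.EqOn ((betaRep a₀ b₀ ha₀ hb₀).prod r).integrand
              ((betaRep a₀ b₀ ha₀ hb₀).prod r₁).integrand ((betaRep a₀ b₀ ha₀ hb₀).prod r₁).domain ∧
            Set.EqOn ((betaRep a₀ b₀ ha₀ hb₀).prod r).integrand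
              ((betaRep a₀ b₀ ha₀ hb₀).prod r₂).integrand ((betaRep a₀ b₀ ha₀ hb₀).prod r₂).domain ∧
            x = of ((betaRep a₀ b₀ ha₀ hb₀).prod r) - of ((betaRep a₀ b₀ ha₀ hb₀).prod r₁) -
              of ((betaRep a₀ b₀ ha₀ hb₀).prod r₂)} ∪
        {x : FormalRep | ∃ (n : ℕ) (r r₁ r₂ : IntegralRep n),
            ((betaRep a₀ b₀ ha₀ hb₀).prod r₁).domain = ((betaRep a₀ b₀ ha₀ hb₀).prod r).domain ∧
            ((betaRep a₀ b₀ ha₀ hb₀).prod r₂).domain = ((betaRep a₀ b₀ ha₀ hb₀).prod r).domain ∧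
            Set.EqOn ((betaRep a₀ b₀ ha₀ hb₀).prod r).integrand
              (((betaRep a₀ b₀ ha₀ hb₀).prod r₁).integrand +
                ((betaRep a₀ b₀ ha₀ hb₀).prod r₂).integrand) ((betaRep a₀ b₀ ha₀ hb₀).prod r).domain ∧
            x = of ((betaRep a₀ b₀ ha₀ hb₀).prod r) - of ((betaRep a₀ b₀ ha₀ hb₀).prod r₁) -
              of ((betaRep a₀ b₀ ha₀ hb₀).prod r₂)} ∪
        {x : FormalRep | ∃ (n : ℕ) (r r' : IntegralRep n)
            (Φ : (Fin (1 + n) → ℝ) → (Fin (1 + n) → ℝ))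
            (Φ' : (Fin (1 + n) → ℝ) → (Fin (1 + n) → ℝ) →L[ℝ] (Fin (1 + n) → ℝ))
            (ψ : (Fin n → ℝ) → (Fin n → ℝ)) (ψ' : (Fin n → ℝ) → (Fin n → ℝ) →L[ℝ] (Fin n → ℝ)),
            (∀ z ∈ ((betaRep a₀ b₀ ha₀ hb₀).prod r).domain,
              HasFDerivWithinAt Φ (Φ' z) ((betaRep a₀ b₀ ha₀ hb₀).prod r).domain z) ∧
            Set.InjOn Φ ((betaRep a₀ b₀ ha₀ hb₀).prod r).domain ∧
            ((betaRep a₀ b₀ ha₀ hb₀).prod r').domain = Φ '' ((betaRep a₀ b₀ ha₀ hb₀).prod r).domain ∧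
            (∀ z ∈ ((betaRep a₀ b₀ ha₀ hb₀).prod r).domain,
              ((betaRep a₀ b₀ ha₀ hb₀).prod r).integrand z =
                ((betaRep a₀ b₀ ha₀ hb₀).prod r').integrand (Φ z) * |(Φ' z).det|) ∧
            IsSemialgebraicMapOn ℚ r.domain ψ ∧
            (∀ z ∈ ((betaRep a₀ b₀ ha₀ hb₀).prod r).domain,
              (fun j => Φ z (Fin.natAdd 1 j)) = ψ (fun j => z (Fin.natAdd 1 j))) ∧
            (∀ w ∈ r.domain, HasFDerivWithinAt ψ (ψ' w) r.domain w) ∧ Set.InjOn ψ r.domain ∧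
            x = of ((betaRep a₀ b₀ ha₀ hb₀).prod r) - of ((betaRep a₀ b₀ ha₀ hb₀).prod r')} ∪
        {x : FormalRep | ∃ (n : ℕ) (s : IntegralRep (n + 1)) (s' : IntegralRep n)
            (a b : (Fin (1 + n) → ℝ) → ℝ) (F : (Fin (1 + n + 1) → ℝ) → ℝ),
            IsSemialgebraicFunOn ℚ ((betaRep a₀ b₀ ha₀ hb₀).prod s).domain F ∧
            IsSemialgebraicFunOn ℚ ((betaRep a₀ b₀ ha₀ hb₀).prod s').domain a ∧
            IsSemialgebraicFunOn ℚ ((betaRep a₀ b₀ ha₀ hb₀).prod s').domain b ∧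
            (∀ x ∈ ((betaRep a₀ b₀ ha₀ hb₀).prod s').domain, a x ≤ b x) ∧
            ((betaRep a₀ b₀ ha₀ hb₀).prod s).domain =
              {z | (Fin.init z : Fin (1 + n) → ℝ) ∈ ((betaRep a₀ b₀ ha₀ hb₀).prod s').domain ∧
                a (Fin.init z) ≤ z (Fin.last (1 + n)) ∧ z (Fin.last (1 + n)) ≤ b (Fin.init z)} ∧
            (∀ x ∈ ((betaRep a₀ b₀ ha₀ hb₀).prod s').domain,
              ContinuousOn (fun t : ℝ => F (Fin.snoc x t)) (Set.Icc (a x) (b x))) ∧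
            (∀ x ∈ ((betaRep a₀ b₀ ha₀ hb₀).prod s').domain, ∀ t ∈ Set.Ioo (a x) (b x),
              HasDerivAt (fun u : ℝ => F (Fin.snoc x u))
                (((betaRep a₀ b₀ ha₀ hb₀).prod s).integrand (Fin.snoc x t)) t) ∧
            (∀ x ∈ ((betaRep a₀ b₀ ha₀ hb₀).prod s').domain,
              ((betaRep a₀ b₀ ha₀ hb₀).prod s').integrand x =
                F (Fin.snoc x (b x)) - F (Fin.snoc x (a x))) ∧
            x = of ((betaRep a₀ b₀ ha₀ hb₀).prod s) - of ((betaRep a₀ b₀ ha₀ hb₀).prod s')})) :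
    Equivalent r₀ r₀' := by
  refine stub_catalyticProductDescent (betaRep a₀ b₀ ha₀ hb₀) (betaRep_value_pos a₀ b₀ ha₀ hb₀).ne'
    (fun n r => (betaRep a₀ b₀ ha₀ hb₀).prod r) (fun n r => rfl)
    (fun n r => by rw [IntegralRep.prod_integrand_eq]; rfl) (of r₀ - of r₀') ?_
  have hLof : ∀ {m : ℕ} (t : IntegralRep m),
      (FreeAbelianGroup.lift fun s : (Σ n, IntegralRep n) => of ((betaRep a₀ b₀ ha₀ hb₀).prod s.2))
        (of t) = of ((betaRep a₀ b₀ ha₀ hb₀).prod t) := fun t => by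
    simp [of]
  rw [map_sub, hLof, hLof]
  exact hc

end Corollaries

end Summit.KontsevichZagierPeriods.KontsevichZagierPeriods.BetaCancellationLine

end
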